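import Summits.Ventures.PackingBounds.Energy.TenPointCkSixDefs
import Summits.Ventures.PackingBounds.Energy.TenPointCkSixMono
import Summits.Ventures.PackingBounds.Energy.TenPointCkSixGramFacts
import Summits.Ventures.PackingBounds.Energy.TenPointCkSixCongrFacts
import Summits.Ventures.PackingBounds.Energy.TenPointCkSixSOSMerge1x0
import Summits.Ventures.PackingBounds.Energy.TenPointCkSixSOSMerge1x1
import Summits.Ventures.PackingBounds.Energy.TenPointCkSixSOSMerge1x2
import Summits.Ventures.PackingBounds.Energy.TenPointCkSixSOSMerge1x3
import Summits.Ventures.PackingBounds.Energy.TenPointCkSixSOSMerge1x4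
import Summits.Ventures.PackingBounds.Energy.TenPointCkSixSOSMerge2x0
import Summits.Ventures.PackingBounds.Energy.TenPointCkSixSOSMerge2x1
import Summits.Ventures.PackingBounds.Energy.TenPointCkSixSOSPart0
import Summits.Ventures.PackingBounds.Energy.TenPointCkSixSOSPart1
import Summits.Ventures.PackingBounds.Energy.TenPointCkSixSOSPart10
import Summits.Ventures.PackingBounds.Energy.TenPointCkSixSOSPart11
import Summits.Ventures.PackingBounds.Energy.TenPointCkSixSOSPart12
import Summits.Ventures.PackingBounds.Energy.TenPointCkSixSOSPart13
import Summits.Ventures.PackingBounds.Energy.TenPointCkSixSOSPart14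
import Summits.Ventures.PackingBounds.Energy.TenPointCkSixSOSPart2
import Summits.Ventures.PackingBounds.Energy.TenPointCkSixSOSPart3
import Summits.Ventures.PackingBounds.Energy.TenPointCkSixSOSPart4
import Summits.Ventures.PackingBounds.Energy.TenPointCkSixSOSPart5
import Summits.Ventures.PackingBounds.Energy.TenPointCkSixSOSPart6
import Summits.Ventures.PackingBounds.Energy.TenPointCkSixSOSPart7
import Summits.Ventures.PackingBounds.Energy.TenPointCkSixSOSPart8
import Summits.Ventures.PackingBounds.Energy.TenPointCkSixSOSPart9
import Summits.Ventures.PackingBounds.Energy.GramListQuadL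
import HarnessLib

/-!
# `TenPointCkSix`: the slack of the three-point inequality is `(1/K)·mᵀ X m` for the kernel-checked `X = P (S·Y) Pᵀ`, hence nonnegative

Framing: lottery ticket; floor = certified bounds/negative ranges. Venture `PackingBounds`, cell
`pub-packcert`, energy family E3PT (pub-packcert-energy gen 15; n = 4, d = 8 kernel route = KERNEL-D6 double data route, size-split, list-route SOS bridge).
`listQuad_partsW6`: `listQuad (mvecW6 u v t) xW6 0` = `quadL` over the explicit monomial list (`GramData.quadL_eq_listQuad`) = the sum of the
15 block polynomials of `TenPointCkSixSOSPart*` (`GramData.quadL_append`; the blocks concatenate to `xW6` by `rfl`); `sum_parts_eqW6`: the merge tree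
`TenPointCkSixSOSMerge*` collects them into 2 polynomial(s). `slack_bridgeW6`: `K · slack(u,v,t)` equals that sum (`ring` on collected polynomials).
`slack_nonnegW6`: by `GramData.listQuad_nonneg_of_congr` from the kernel-checked facts `PentagonsSixD8.congrW6_all` (congruence), `rowsW6_all` /
`ddW6_all` (PSD of S·Y).
-/

noncomputable section

namespace Summit.Ventures.PackingBounds.Energy.TenPointCkSix

open Summit.Ventures.PackingBounds.Energy.GramData Summit.Ventures.PackingBounds.Energy.PentagonsSixD8

set_option maxRecDepth 100000 in
/-- The table `xW6` is the concatenation of the row blocks of the part files. -/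
theorem xW6_split : xW6 = xPart0W6 ++ (xPart1W6 ++ (xPart2W6 ++ (xPart3W6 ++ (xPart4W6 ++ (xPart5W6 ++ (xPart6W6 ++ (xPart7W6 ++ (xPart8W6 ++ (xPart9W6 ++ (xPart10W6 ++ (xPart11W6 ++ (xPart12W6 ++ (xPart13W6 ++ xPart14W6))))))))))))) := rfl

set_option maxRecDepth 100000 in
set_option maxHeartbeats 400000000 in
/-- `listQuad` over `xW6` with the monomial vector is the sum of the block polynomials. -/
theorem listQuad_partsW6 (u v t : ℝ) : listQuad (mvecW6 u v t) xW6 0 = SosPoly0KW6 u v t + SosPoly1KW6 u v t + SosPoly2KW6 u v t + SosPoly3KW6 u v t + SosPoly4KW6 u v t + SosPoly5KW6 u v t + SosPoly6KW6 u v t + SosPoly7KW6 u v t + SosPoly8KW6 u v t + SosPoly9KW6 u v t + SosPoly10KW6 u v t + SosPoly11KW6 u v t + SosPoly12KW6 u v t + SosPoly13KW6 u v t + SosPoly14KW6 u v t := by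
  have hL : (mlistW6 u v t).length = 165 := mlist_lengthW6 u v t
  have hrow : ∀ row ∈ xW6, row.length ≤ (mlistW6 u v t).length := by
    rw [hL]; exact (by decide +kernel : ∀ row ∈ xW6, row.length ≤ 165)
  have hlen : xW6.length + 0 ≤ (mlistW6 u v t).length := by rw [hL]; decide
  rw [← quadL_eq_listQuad (mvecW6 u v t) (mlistW6 u v t) (fun k _ => rfl) xW6 0 hrow hlen, mdrop0W6]
  rw [xW6_split, quadL_append, xPart0_lengthW6, mdrop1W6, quadL_append, xPart1_lengthW6, mdrop2W6, quadL_append, xPart2_lengthW6, mdrop3W6, quadL_append, xPart3_lengthW6, mdrop4W6, quadL_append, xPart4_lengthW6, mdrop5W6, quadL_append, xPart5_lengthW6, mdrop6W6, quadL_append, xPart6_lengthW6, mdrop7W6, quadL_append, xPart7_lengthW6, mdrop8W6, quadL_append, xPart8_lengthW6, mdrop9W6, quadL_append, xPart9_lengthW6, mdrop10W6, quadL_append, xPart10_lengthW6, mdrop11W6, quadL_append, xPart11_lengthW6, mdrop12W6, quadL_append, xPart12_lengthW6, mdrop13W6, quadL_append, xPart13_lengthW6, mdrop14W6, sospart0_eqW6,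 sospart1_eqW6, sospart2_eqW6, sospart3_eqW6, sospart4_eqW6, sospart5_eqW6, sospart6_eqW6, sospart7_eqW6, sospart8_eqW6, sospart9_eqW6, sospart10_eqW6, sospart11_eqW6, sospart12_eqW6, sospart13_eqW6, sospart14_eqW6]; ring

/-- The merge tree: the sum of the block polynomials equals `SosMrg2x0KW6 u v t + SosMrg2x1KW6 u v t`. -/
theorem sum_parts_eqW6 (u v t : ℝ) : SosPoly0KW6 u v t + SosPoly1KW6 u v t + SosPoly2KW6 u v t + SosPoly3KW6 u v t + SosPoly4KW6 u v t + SosPoly5KW6 u v t + SosPoly6KW6 u v t + SosPoly7KW6 u v t + SosPoly8KW6 u v t + SosPoly9KW6 u v t + SosPoly10KW6 u v t + SosPoly11KW6 u v t + SosPoly12KW6 u v t + SosPoly13KW6 u v t + SosPoly14KW6 u v t = SosMrg2x0KW6 u v t + SosMrg2x1KW6 u v t := by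
  linear_combination sosmrg1x0_eqW6 u v t + sosmrg1x1_eqW6 u v t + sosmrg1x2_eqW6 u v t + sosmrg1x3_eqW6 u v t + sosmrg1x4_eqW6 u v t + sosmrg2x0_eqW6 u v t + sosmrg2x1_eqW6 u v t

set_option maxRecDepth 100000 in
set_option maxHeartbeats 400000000 in
/-- `K · slack(u,v,t) = m(u,v,t)ᵀ X m(u,v,t)` with `K = scaleXW6` (block identities, merge tree, then `ring` on collected polynomials). -/
theorem slack_bridgeW6 (u v t : ℝ) :
    (scaleXW6 : ℝ) * ((pminKW6 u + pminKW6 v + pminKW6 t) / 3 - (c0KW6 + 8 * FexpKW6 u v t + FexpKW6 u u 1 + FexpKW6 v v 1 + FexpKW6 t t 1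
      + (aPolyKW6 u + aPolyKW6 v + aPolyKW6 t) / 3))
      = listQuad (mvecW6 u v t) xW6 0 := by
  rw [listQuad_partsW6, sum_parts_eqW6]
  unfold pminKW6 FexpKW6 FexpK_c0W6 FexpK_c1W6 FexpK_c2W6 FexpK_c3W6 FexpK_c4W6 FexpK_c5W6 c0KW6 aPolyKW6 scaleXW6 SosMrg2x0KW6 SosMrg2x0K_c0W6 SosMrg2x0K_c1W6 SosMrg2x0K_c2W6 SosMrg2x0K_c3W6 SosMrg2x0K_c4W6 SosMrg2x0K_c5W6 SosMrg2x0K_c6W6 SosMrg2x0K_c7W6 SosMrg2x0K_c8W6 SosMrg2x0K_c9W6 SosMrg2x1KW6 SosMrg2x1K_c0W6 SosMrg2x1K_c1W6 SosMrg2x1K_c2W6 SosMrg2x1K_c3W6 SosMrg2x1K_c4W6 SosMrg2x1K_c5W6 SosMrg2x1K_c6W6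
  push_cast
  ring

set_option maxRecDepth 100000 in
set_option maxHeartbeats 0 in
/-- The slack polynomial of the three-point inequality (`N - 2 = 8`) is nonnegative everywhere: it is `(1/K)·mᵀ X m` with
`X = P (S·Y) Pᵀ` and `S·Y = L Lᵀ + E` (E diagonally dominant), all checked by kernel evaluation on integer data. -/
theorem slack_nonnegW6 (u v t : ℝ) :
    0 ≤ (pminKW6 u + pminKW6 v + pminKW6 t) / 3 - (c0KW6 + 8 * FexpKW6 u v t + FexpKW6 u u 1 + FexpKW6 v v 1 + FexpKW6 t t 1
      + (aPolyKW6 u + aPolyKW6 v + aPolyKW6 t) / 3) := by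
  have hK : (0 : ℝ) < (scaleXW6 : ℝ) := by unfold scaleXW6; norm_num
  have hXlen : xW6.length = 165 := by decide
  have hXrow : ∀ m, m < 165 → (xW6.getD m []).length = 165 := by decide +kernel
  have hB : ∀ a, a < 165 → (bW6.getD a []).length = 153 := by decide +kernel
  have h := listQuad_nonneg_of_congr 165 153 153 bW6 yW6 xW6 lW6 eW6 hXlen hXrow hB congrW6_all rowsW6_all
    (of_checkDD ddW6_all) (mvecW6 u v t)
  rw [← slack_bridgeW6] at h
  exact (mul_nonneg_iff_of_pos_left hK).1 h

end Summit.Ventures.PackingBounds.Energy.TenPointCkSix
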